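import Mathlib
import Summits.Ventures.Crystal3D.Theorems.StickyWulffConstantTextureLiminfTexShadowVocabulary
import HarnessLib

/-!
# Line `TexShadow` for the crux `TextureLiminf` (stmt-Ventures-19483) — FREE-CERTIFICATE VOCABULARY file (v6.2)

HONEST FRAMING. Part of the venture `Summits/Ventures/Crystal3D` (cell `crystal3d-full`), route
`route-Ventures-StickyWulffConstant`, crux `TextureLiminf` (stmt-Ventures-19483).  This file carries, VERBATIM
(def bodies and docstrings byte-identical modulo whitespace), the part of the vocabulary of the planner's REGISTERED
skeleton `HOME/cf-p1/route/lines/tex/TexShadow.lean` (v6.2, planner crystal3d-full-p1 gen 20, §2 «new vocabulary of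
the line») that the signature of the registered stub `stub_barlowFreeCertificate : BarlowFreeCertificate` mentions
and that is not already in the tree's `…TexShadowVocabulary.lean` (`e₃ fccRef phiB wulffOf …`) /
`…TexShadowDefs.lean` (`E3 perK per polytope …`): `stacking`, `perKIn`, `bilayer`, `laySlab`, `brokenNearIn`,
`BarlowFreeCertificate` — so that this stub can be proved BY NAME in `Theorems/` files (eng g9; cf-p1 g21 INBOX
2026-08-27T18:45:48Z «land it defs-only … so barlowFreeCertificate can be stated by name»).  The wall vocabulary
(`cube`, `cyl`, `innerBonds`, `BarlowResolution`, `BarlowAdhesionR`, `BilayerWall`) is deliberately NOT here (still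
being re-typed: ROUTE.md §77–§79).  Definitions only; nothing is proved or claimed here.  `perKIn K G U` is
`Literature.Analysis.Convexity.anisotropicPerimeterIn K G U` by `rfl` (lit g10, `AnisotropicPerimeterLocalized.lean`).
WHAT THIS IS NOT: any statement about the stub; rung F-C1 not moved.
-/

open scoped BigOperators InnerProductSpace ENNReal
open MeasureTheory Filter

namespace Summit.Ventures.Crystal3D.Cruxes.TextureLiminf.TexShadow

open Summit.Ventures.Crystal3D
open Literature.MathematicalPhysics.StatisticalMechanics (fccStacking barlowStacking IsHaggSeq
  fieldDivergence HasFinitePerimeter contactDeficiency)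

/-! ## §2 (part) Vocabulary of the free certificate (verbatim from `TexShadow.lean` v6.2) -/

/-- the moved Barlow stacking with frame `L`, origin `s`, Hägg word `σ` (nn distance `1`). -/
def stacking (L : E3 ≃ₗᵢ[ℝ] E3) (s : E3) (σ : ℤ → ℤ) : Set E3 :=
  (fun r => L r + s) '' barlowStacking 1 (Real.sqrt (2 / 3)) σ

/-- localized distributional `K`-perimeter: test fields with (topological) support inside `U`.  With
`U = univ` this is `perK`.  Stated in `ℝ≥0∞` so that no `toReal` junk value can enter an inequality. -/
noncomputable def perKIn (K G U : Set E3) : ℝ≥0∞ :=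
  ⨆ (ξ : E3 → E3) (_ : ContDiff ℝ 1 ξ ∧ HasCompactSupport ξ ∧ (∀ z, ξ z ∈ K) ∧ tsupport ξ ⊆ U),
    ENNReal.ofReal (∫ z in G, fieldDivergence ξ z)

/-- the close-packed BILAYER (layers `i`, `i+1`) of a moved stacking … -/
def bilayer (L : E3 ≃ₗᵢ[ℝ] E3) (s : E3) (σ : ℤ → ℤ) (i : ℤ) : Set E3 :=
  (fun r => L r + s) '' {r | r ∈ barlowStacking 1 (Real.sqrt (2 / 3)) σ ∧
      (r 2 = (i : ℝ) * Real.sqrt (2 / 3) ∨ r 2 = ((i : ℝ) + 1) * Real.sqrt (2 / 3))}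

/-- the OPEN slab between the close-packed layer planes `i` and `i + 1` of the frame `(L, s)`; it owns the cells
(tetrahedra and octahedra) of bilayer `i` of every stacking with this frame. -/
def laySlab (L : E3 ≃ₗᵢ[ℝ] E3) (s : E3) (i : ℤ) : Set E3 :=
  (fun r => L r + s) '' {r | (i : ℝ) * Real.sqrt (2 / 3) < r 2 ∧ r 2 < ((i : ℝ) + 1) * Real.sqrt (2 / 3)}

/-- ordered BROKEN BONDS of `X ⊆ S` near `U`, relative to the stacking `S`: occupied `a ∈ X`, vacant site
`b ∈ S ∖ X` at distance `1`, with `a` within `√2` (one cell diameter) of `U`.  For `U = univ` this is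
`2·D_S(X) = 2(6#X − b(X))` (every site of a Barlow stacking has `12` neighbours). -/
noncomputable def brokenNearIn (S : Set E3) (X : Finset E3) (U : Set E3) : ℕ :=
  {p : E3 × E3 | p.1 ∈ X ∧ p.2 ∈ S ∧ p.2 ∉ X ∧ dist p.1 p.2 = 1 ∧
      Metric.infDist p.1 U ≤ Real.sqrt 2}.ncard

/-- **FREE CERTIFICATE ON A BARLOW GRAIN, LOCAL ∃-LEVEL FORM** (v6.1 `FREE` = the BARLOW TENT, ROUTE.md §72;
supersedes v5.1's fcc-only `FreeCertificate`, kept in HOME `…/tex/FreeCertificate.lean`; the ∃-level shape is eng g8's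
form (a), INBOX 15:57:48Z — one solid PER OPEN SET, no quadrature, no slice areas, no semicontinuity).  For every Hägg
word `σ`, frame `(L, s)`, table `A` of fcc frames of the bilayers (bilayer `i` of the stacking `S` lies in the moved
reference lattice `A i · fccRef + u`; such a frame exists and its lattice is unique, so `wulffOf (A i)` is THE Wulff
body of bilayer `i`), every finite set `X` of atoms of `S` and EVERY OPEN SET `U`, there is a bounded open polyhedral
solid `G` (intended: `{f_X > t}` for a good generic level `t ∈ (0, 1)`, `f_X` the continuous piecewise-affine TENT of
`1_X` on the tet–oct complex of `S`, octahedra coned at their centres with value `0 / ½ / 1` for `≤ 1 / 2–4 / ≥ 5`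
occupied vertices) which is a finite disjoint union of bounded open convex polytopes with unit normals and distinct
facet planes, every piece inside ONE open layer slab (ready for `PolytopeCalculus`; the slab grains `G ∩ laySlab i`
are unions of pieces; for `t ∉ {0, 1}` no level facet lies on a layer plane, so the planar traces of consecutive slab
grains match and cancel exactly against the `ι_W` terms of the route energy — they are free interfaces in P's law:
equal lattices `c = 0`, twin bilayers co-axial with `K = Dsc(m) ⊥` the plane); which lies within `√2` of the atoms;
which contains, up to a null set, every point all of whose `S`-sites within `√2` are occupied (mass, and seamless
sewing to wall fills through fully occupied material); and whose SLAB-WISE Wulff perimeter inside `U` — slab `i`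
weighted by its own bilayer body `wulffOf (A i)`, test fields supported inside `U ∩ laySlab i` — is at most HALF the
number of broken `S`-bonds of `X` near `U` (for `U = univ`: `≤ D_S(X) = 6#X − b(X)`).  WHY TRUE: every cell of the
complex lies in one bilayer ≅ the fcc bilayer, so lit's kernel-checked per-cell tables (`tentCost24_le`: tetrahedron
`= e/12`, octahedron `≤ e/6`, in the cell's own frame; `Φ_{gΛ}(g p) = Φ_Λ(p)`, `|g c| = |c|`) transport verbatim;
every bond of `S` lies in exactly `2` tetrahedra `+ 2` octahedra (in-plane: `1 + 1` on each side of its layer plane,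
because the layer plane is a union of cell faces and each of the two layer triangles at the bond is capped by a
tetrahedron or is an octahedron face, one each; inter-layer: inside its bilayer as in fcc), so
`∫₀¹ cost_U(t) dt = Σ_{cells meeting U} |c| Φ_c(∇f_X) ≤ (2/12 + 2/6)·#{broken bonds in those cells} ≤
½·brokenNearIn S X U` (a cell meeting `U` has all its vertices within its diameter `≤ √2` of `U`); eng g8's
localised (T2) `perKIn K {f>t} V ≤ Σ_{cells with closure meeting V} h_K(n_c)·area_c(t)` applied per slab with
`V = U ∩ laySlab i`, `K = wulffOf (A i)` (only bilayer-`i` cells meet `V`); a good generic level by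
`exists_mem_Ioo_le_of_lintegral_le` (CavalieriSlices).  STRONGER U-UNIFORM ALTERNATIVES (not needed by the
consumer, who tests each grain against ONE open free zone): 2-point Radau per half — three nested solids
`3P(G_{1/6}) + 2P(G_{1/2}) + 3P(G_{5/6}) ≤ 4·broken` (eng (b)) — or the six interior levels `k/16` with weights
`(8, 11, 8, 8, 11, 8) ≤ 27·broken`; both need lit's `SimplexSlices` (slice areas are quadratic splines). -/
def BarlowFreeCertificate : Prop :=
  ∀ σ : ℤ → ℤ, IsHaggSeq σ → ∀ (L : E3 ≃ₗᵢ[ℝ] E3) (s : E3) (A : ℤ → (E3 ≃ₗᵢ[ℝ] E3)),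
    (∀ i, ∃ u : E3, bilayer L s σ i ⊆ (fun r => A i r + u) '' fccRef) →
    ∀ X : Finset E3, (↑X : Set E3) ⊆ stacking L s σ → ∀ U : Set E3, IsOpen U →
    ∃ G : Set E3, HasFinitePerimeter G ∧ volume G < ⊤ ∧
      G ⊆ (⋃ a ∈ X, Metric.closedBall a (Real.sqrt 2)) ∧
      (∃ (J : ℕ) (H : Fin J → Finset (E3 × ℝ)),
        (∀ j, Bornology.IsBounded (polytope (H j))) ∧
        (∀ j, ∀ p ∈ H j, ‖p.1‖ = 1) ∧
        (∀ j, ∀ p ∈ H j, ∀ p' ∈ H j, p ≠ p' →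
          {x : E3 | ⟪p.1, x⟫_ℝ = p.2} ≠ {x | ⟪p'.1, x⟫_ℝ = p'.2}) ∧
        (∀ j j', j ≠ j' → Disjoint (polytope (H j)) (polytope (H j'))) ∧
        (∀ j, ∃ i : ℤ, polytope (H j) ⊆ laySlab L s i) ∧
        G = ⋃ j, polytope (H j)) ∧
      volume ({y : E3 | ∀ b ∈ stacking L s σ, dist y b ≤ Real.sqrt 2 → b ∈ X} \ G) = 0 ∧
      2 * (∑' i : ℤ, perKIn (wulffOf (A i)) G (U ∩ laySlab L s i)) ≤
        (brokenNearIn (stacking L s σ) X U : ℝ≥0∞)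

end Summit.Ventures.Crystal3D.Cruxes.TextureLiminf.TexShadow
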